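import Summits.BirchSwinnertonDyer.BirchSwinnertonDyer.Theorems.PrintCf2SplitBadEisensteinTwoDescent
import Literature.NumberTheory.EllipticCurves.HeegnerHypothesisKroneckerProofs
import HarnessLib

/-!
# Crux `PrintCf2.SplitBadTwoRankOneOfFacts` (item 20368), line `eisenstein_two_bdp_line` — D2c keyed to the ideator's TIED cut
# (`stub_controlValue_two`, Lines v4 1feff295): the tie is PINNED at `t = 1` by D2b, so the tied stub gives the D2a shape of
# `descent_two_of_controlTwo`, hence `stub_descent_two` (modulo Milne 1972)

Cell `bsd-print-cf2`, seat `bsd-line-cf2-p1-w2` (prover, width seat on crux stmt-BirchSwinnertonDyer-20368; lead `bsd-line-cf2-p1` g5, pen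
bsd-idea-7). `--supports stmt-BirchSwinnertonDyer-20368` (helper). Theses-free; THEOREMS ONLY (0 definitions, 0 named facts, 0 `sorry`); CONDITIONAL
on every displayed hypothesis; BSD is proved for no curve by any of this; no summit statement is proved by this seat.

WHAT THIS IS. The pen's v4 of the line file (publish-only) re-cut the registered `stub_descent_two` as `stub_controlValue_two` — «∃ t : ℤ, CONTROL at
`T = 0` at `𝔭′` with defect `t` (the odd-`p` socket's formula `+ t`, split Tamagawa product) ∧ the VALUE of the frame at `𝟙` is `u·(log_ω P/c)²` with
`‖u‖ = 2^{−t}`» — plus `stub_grossLink_two`. This file shows, in the kernel, how that cut meets the w2 cut (`PrintCf2SplitBadEisensteinTwoDescent`):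
* `controlTwo_of_controlValueTied` — for one `W` with `4 ∣ N_W`: frames (stub 1 shape) + torsion (stub T shape) + the TIED statement ⟹ the D2a
  shape `hCtl₂` of the `p = 2` row kernel (control at every degree-one `𝔭` with net correction EXACTLY `+1`, full Tamagawa product over `K`).
  The tie is pinned by D2b: the frame's value at `𝟙` is `u′·(log_ω P/c)²` with `‖u′‖ = 1/2` (`intSeries_value_of_frame_manin_two`), the value is
  functional in the frame (`R1.intSeries_eq_constantCoeff_of_hasValueAt_zero`), `log_ω P ≠ 0`, so `2^{−t} = 2^{−1}`, `t = 1`; and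
  `ord₂ ∏_{w ∣ N⁺} c_w = ord₂ ∏_w c_w(E_K)` at a Heegner field (`X11b.padicValNat_tamagawaProductSplit_eq_of_heegner_prime`). `d_K < −4` is automatic:
  `2 ∣ N_W` and the Heegner hypothesis give `d_K ≡ 1 (mod 8)`.
* **`descent_two_of_controlValueTied (hMilne) (hCV : <statement of v4's stub_controlValue_two VERBATIM>) : <body of stub_descent_two VERBATIM>`**
  — so under EITHER registry choice (lead's `stub_controlTwo` of the w2 TURNKEY, or pen's tied `stub_controlValue_two`) the old stub 4 is a
  theorem modulo that one research stub and Milne 1972; v4's `stub_grossLink_two` is not needed (the over-`K` road of cell bsd-p2 replaces it).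

References: [JetchevSkinnerWan2017] Thm. 3.3.1, §7.4.1; [LiuZhangZhang2018] Thm 1.5.1/1.5.3; [Milne1972ArithmeticAV] §1 Thm. 1; [Cox2013] Prop. 5.16.
-/

set_option autoImplicit false

-- D-0017 layout: summit = sub-problem, so `Summit.BirchSwinnertonDyer.BirchSwinnertonDyer.…` is the mandated namespace of Theorems files.
set_option linter.dupNamespace false

noncomputable section

open scoped Classical MatrixGroups ModularForm Topology NumberField

namespace Summit.BirchSwinnertonDyer.BirchSwinnertonDyer.Theorems.PrintCf2.EisensteinTwo

open Filter CongruenceSubgroup WeierstrassCurve NumberField IsDedekindDomain Field PowerSeries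
  Literature.NumberTheory.EllipticCurves Literature.NumberTheory.EllipticCurves.ModularForms
  Literature.NumberTheory.EllipticCurves.LiuZhangZhang2018 Literature.NumberTheory.EllipticCurves.Rank1Residual
  Literature.NumberTheory.EllipticCurves.Rank1Residual.Typed Literature.NumberTheory.EllipticCurves.KrizLi2019
  Literature.NumberTheory.GaloisRepresentations Literature.NumberTheory.GaloisCohomology
  Summit.BirchSwinnertonDyer.Rank1Residual Summit.BirchSwinnertonDyer.Rank1Residual.X11b
  Summit.BirchSwinnertonDyer.Rank1Residual.X11b.AcSelmer Summit.BirchSwinnertonDyer.Rank1Residual.X11b.CongruenceLimit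
  Summit.BirchSwinnertonDyer.Rank1Residual.X11b.Halves Summit.BirchSwinnertonDyer.Rank1Residual.X2
  Summit.BirchSwinnertonDyer.Rank1Residual.Additive
  Summit.BirchSwinnertonDyer.BirchSwinnertonDyer.Theses.UniversalToricDescent
  Summit.BirchSwinnertonDyer.BirchSwinnertonDyer.Theorems.UniversalToricDescentWaldspurgerFlat

/-- **The TIED cut pins `t = 1`: frames + torsion + `stub_controlValue_two`-shape ⟹ the D2a shape `hCtl₂` of the `p = 2` row kernel.** For one
globally minimal `W/ℚ` with `4 ∣ N_W`: IF the integral ♭-BDP frames exist at every anticyclotomic frame (stub 1 shape), `X_(∅,0)` is `Λ`-torsion at the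
opposite prime (stub T shape), and at every Heegner datum / frame / ♭-frame the TIED statement holds (`∃ t`, control at `𝔭′` with defect `t` ∧ value
`u·(log_ω P/c)²` at `𝔭` with `‖u‖ = 2^{−t}` — the body of the pen's v4 `stub_controlValue_two` for this `W`), THEN at every Heegner datum with
`L(E^{(d_K)},1) ≠ 0`, `P` non-torsion, Kolyvagin, every anticyclotomic `(κ, γ)` and degree-one `𝔭 ∣ 2`:
`∃ n, XAc.HasCharValuationAt (W.baseChange K) 2 κ 𝔭 ∅ γ n ∧ n = ord₂ #Ш(E_K)[2^∞] + 2·(padicLogOrd − ord₂ [E(K):ℤP]) + ord₂ ∏_w c_w(E_K) + 1`.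
Proof: pick the OTHER degree-one prime `𝔭₀`, an embedding datum inducing it and a frame there; the tied statement at `(𝔭₀, 𝔭)` gives `t`; D2b at `𝔭₀`
(`intSeries_value_of_frame_manin_two`, `d_K < −4` from `d_K ≡ 1 (mod 8)`) and functionality of the value pin `‖u‖ = 1/2 = 2^{−t}`, so `t = 1`;
the split Tamagawa product has the valuation of the full one at a Heegner field. CONDITIONAL on `hL`.
[cite: LiuZhangZhang2018, Thm 1.5.1 and Thm 1.5.3 (Duke Math. J. 167 pp. 748–749)] [cite: JetchevSkinnerWan2017, Thm. 3.3.1 (arXiv:1512.06894 p. 11) (shape)]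
[cite: Cox2013, §5.B Prop. 5.16 (p. 105) (2 split ⟺ d_K ≡ 1 mod 8)] -/
theorem controlTwo_of_controlValueTied (hL : thm151_thm153_modularCurve_heegnerVector_additive)
    (W : WeierstrassCurve ℚ) [W.IsElliptic] [W.IsGloballyMinimal] (h4N : 2 ^ 2 ∣ W.conductorNorm ℤ)
    (hFr : ∀ (N : ℕ) [NeZero N] (K : Type) [Field K] [NumberField K] (Dt : ModularParametrizationData W N),
      W.conductorNorm ℤ = N → IsImaginaryQuadratic K → SatisfiesHeegnerHypothesis N K →
      ∀ (κ : ZpExtension K 2), κ.IsAnticyclotomic → ∀ (γ : Field.absoluteGaloisGroup K) [Fact (κ.IsTopGenerator γ)]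
        (𝔭 : HeightOneSpectrum (𝓞 K)), ((2 : ℕ) : 𝓞 K) ∈ 𝔭.asIdeal → 𝔭.asIdeal.ramificationIdx (𝓞 ℚ) = 1 →
        𝔭.asIdeal.inertiaDeg (𝓞 ℚ) = 1 → ∀ (ι' : PadicAlgCl 2 ≃+* ℂ), SchneiderFree.BranchInducesPrime 2 ι' 𝔭 →
        ∃ (ΩK : ℂ) (Ωp : ℂ_[2]) (Q : PowerSeries (PadicComplexInt 2)),
          ΩK ≠ 0 ∧ Ωp ≠ 0 ∧ R1.IsBDPLFunctionInt 2 ι' 𝔭 κ γ Dt.f ΩK Ωp Q)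
    (hTor : ∀ (N : ℕ) [NeZero N] (K : Type) [Field K] [NumberField K],
      W.conductorNorm ℤ = N → IsImaginaryQuadratic K → SatisfiesHeegnerHypothesis N K →
      ∀ (κ : ZpExtension K 2), κ.IsAnticyclotomic → ∀ (γ : Field.absoluteGaloisGroup K) [Fact (κ.IsTopGenerator γ)]
        (𝔭 : HeightOneSpectrum (𝓞 K)), ((2 : ℕ) : 𝓞 K) ∈ 𝔭.asIdeal → 𝔭.asIdeal.ramificationIdx (𝓞 ℚ) = 1 →
        𝔭.asIdeal.inertiaDeg (𝓞 ℚ) = 1 → ∀ (𝔭' : HeightOneSpectrum (𝓞 K)), ((2 : ℕ) : 𝓞 K) ∈ 𝔭'.asIdeal → 𝔭' ≠ 𝔭 →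
        Module.IsTorsion (IwasawaAlgebra 2) (XAc (W.baseChange K) 2 κ 𝔭' ∅ γ))
    (hCV : ∀ (N : ℕ) [NeZero N] (K : Type) [Field K] [NumberField K] (Dt : ModularParametrizationData W N)
      (H : HeegnerDatum N (NumberField.discr K)) (ιK : K →+* ℂ) (P : (W.baseChange K).toAffine.Point),
      W.conductorNorm ℤ = N → IsImaginaryQuadratic K → SatisfiesHeegnerHypothesis N K →
      WeierstrassCurve.Affine.Point.map ιK.toRatAlgHom P = heegnerPointComplex Dt H → ¬ IsOfFinAddOrder P →
      ∀ (κ : ZpExtension K 2), κ.IsAnticyclotomic → ∀ (γ : Field.absoluteGaloisGroup K) [Fact (κ.IsTopGenerator γ)]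
        (𝔭 : HeightOneSpectrum (𝓞 K)) (h𝔭 : ((2 : ℕ) : 𝓞 K) ∈ 𝔭.asIdeal) (he : 𝔭.asIdeal.ramificationIdx (𝓞 ℚ) = 1)
        (hf : 𝔭.asIdeal.inertiaDeg (𝓞 ℚ) = 1) (𝔭' : HeightOneSpectrum (𝓞 K)) (h𝔭' : ((2 : ℕ) : 𝓞 K) ∈ 𝔭'.asIdeal),
        𝔭' ≠ 𝔭 → ∀ (he' : 𝔭'.asIdeal.ramificationIdx (𝓞 ℚ) = 1) (hf' : 𝔭'.asIdeal.inertiaDeg (𝓞 ℚ) = 1)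
        (ι' : PadicAlgCl 2 ≃+* ℂ), SchneiderFree.BranchInducesPrime 2 ι' 𝔭 →
        ∀ (ΩK : ℂ) (Ωp : ℂ_[2]) (Q : PowerSeries (PadicComplexInt 2)), ΩK ≠ 0 → Ωp ≠ 0 →
          R1.IsBDPLFunctionInt 2 ι' 𝔭 κ γ Dt.f ΩK Ωp Q →
          Module.IsTorsion (IwasawaAlgebra 2) (XAc (W.baseChange K) 2 κ 𝔭' ∅ γ) →
          ∃ t : ℤ,
            (∃ n : ℕ, XAc.HasCharValuationAt (W.baseChange K) 2 κ 𝔭' ∅ γ n ∧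
              (n : ℤ) = (padicValNat 2 (Nat.card (AddCommGroup.primaryComponent (W.baseChange K).sha 2)) : ℤ) +
                2 * (X11b.padicLogOrd W 2 (embAt K 2 𝔭' h𝔭' he' hf') P -
                  (padicValNat 2 (AddSubgroup.zmultiples P).index : ℤ)) +
                padicValNat 2 (X11b.tamagawaProductSplit W K) + t) ∧
            ∃ u : ℂ_[2], ‖u‖ = (2 : ℝ) ^ (-t) ∧
              IntSeries.HasValueAt Q 0
                (u * (algebraMap ℚ_[2] ℂ_[2] (logOmega W 2 (embAt K 2 𝔭 h𝔭 he hf) P / (Dt.c : ℚ_[2]))) ^ 2)) :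
    ∀ (N : ℕ) [NeZero N] (K : Type) [Field K] [NumberField K] (Dt : ModularParametrizationData W N)
      (H : HeegnerDatum N (NumberField.discr K)) (ι : K →+* ℂ) (P : (W.baseChange K).toAffine.Point),
      W.conductorNorm ℤ = N → IsImaginaryQuadratic K → SatisfiesHeegnerHypothesis N K →
      (W.quadraticTwist (NumberField.discr K : ℚ)).entireLFunction 1 ≠ 0 →
      WeierstrassCurve.Affine.Point.map ι.toRatAlgHom P = heegnerPointComplex Dt H → ¬ IsOfFinAddOrder P →
      Literature.NumberTheory.EllipticCurves.kolyvagin N W K →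
      ∀ (κ : ZpExtension K 2), κ.IsAnticyclotomic → ∀ (γ : Field.absoluteGaloisGroup K) [Fact (κ.IsTopGenerator γ)]
        (𝔭 : HeightOneSpectrum (𝓞 K)) (h𝔭 : ((2 : ℕ) : 𝓞 K) ∈ 𝔭.asIdeal) (he : 𝔭.asIdeal.ramificationIdx (𝓞 ℚ) = 1)
        (hf : 𝔭.asIdeal.inertiaDeg (𝓞 ℚ) = 1),
        ∃ n : ℕ, XAc.HasCharValuationAt (W.baseChange K) 2 κ 𝔭 ∅ γ n ∧
          (n : ℤ) = (padicValNat 2 (Nat.card (AddCommGroup.primaryComponent (W.baseChange K).sha 2)) : ℤ) +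
            2 * (X11b.padicLogOrd W 2 (embAt K 2 𝔭 h𝔭 he hf) P - (padicValNat 2 (AddSubgroup.zmultiples P).index : ℤ)) +
            (padicValNat 2 (W.baseChange K).tamagawaProduct : ℤ) + 1 := by
  intro N _ K _ _ Dt H ι P hN hK hHN _hLt hP hnt _hKo κ hκ γ _ 𝔭 h𝔭 he hf
  have h2N : (2 : ℕ) ∣ N := hN ▸ dvd_trans (dvd_pow_self 2 two_ne_zero) h4N
  have h4N' : 2 ^ 2 ∣ N := hN ▸ h4N
  -- `d_K ≡ 1 (mod 8)`, so `d_K < −4`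
  have hd8 : NumberField.discr K % 8 = 1 := Literature.SatisfiesHeegnerHypothesis.discr_emod_eight hK.1 hHN h2N
  have hdneg : NumberField.discr K < 0 := IsImaginaryQuadratic.discr_neg hK
  have hd4 : NumberField.discr K < -4 := by omega
  -- the other degree-one prime `𝔭₀`, an embedding datum inducing it, a ♭-frame there, torsion at `𝔭`
  obtain ⟨𝔭₀, hne, h𝔭₀, he₀, hf₀⟩ := X11b.Three.exists_ne_degreeOne_prime hK.1 h𝔭 he hf
  obtain ⟨ι₀⟩ := PadicAlgCl.nonempty_ringEquiv_complex 2
  obtain ⟨ι', -, hind⟩ := exists_datum_forall_mem_iff 2 ι₀ hK h𝔭₀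
  obtain ⟨ΩK, Ωp, Q, hΩK, hΩp, hQ⟩ := hFr N K Dt hN hK hHN κ hκ γ 𝔭₀ h𝔭₀ he₀ hf₀ ι' hind
  have htors : Module.IsTorsion (IwasawaAlgebra 2) (XAc (W.baseChange K) 2 κ 𝔭 ∅ γ) :=
    hTor N K hN hK hHN κ hκ γ 𝔭₀ h𝔭₀ he₀ hf₀ 𝔭 h𝔭 hne.symm
  -- the tied statement at `(𝔭₀, 𝔭)`
  obtain ⟨t, ⟨n, hn, hnf⟩, u, hu, hval⟩ :=
    hCV N K Dt H ι P hN hK hHN hP hnt κ hκ γ 𝔭₀ h𝔭₀ he₀ hf₀ 𝔭 h𝔭 hne.symm he hf ι' hind ΩK Ωp Q hΩK hΩp hQ htors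
  -- D2b at `𝔭₀` pins the value
  obtain ⟨u', hu', hval'⟩ := intSeries_value_of_frame_manin_two hL W K 𝔭₀ κ γ Dt H ι P hN h4N' hK hd4 h𝔭₀ he₀ hf₀ hHN hκ hP hnt
    ι' hind hΩK hΩp hQ
  have hc0 : Dt.c ≠ 0 := Dt.maninConstant_ne_zero_holds
  have hc0' : (Dt.c : ℚ_[2]) ≠ 0 := by exact_mod_cast hc0
  have hlog : logOmega W 2 (embAt K 2 𝔭₀ h𝔭₀ he₀ hf₀) P ≠ 0 := X11b.R1.logOmega_ne_zero W 2 _ hnt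
  have hx0 : (algebraMap ℚ_[2] ℂ_[2] (logOmega W 2 (embAt K 2 𝔭₀ h𝔭₀ he₀ hf₀) P / (Dt.c : ℚ_[2]))) ^ 2 ≠ 0 :=
    pow_ne_zero _ ((map_ne_zero _).mpr (div_ne_zero hlog hc0'))
  have huu : u = u' := by
    have h1 := R1.intSeries_eq_constantCoeff_of_hasValueAt_zero 2 hval
    have h2 := R1.intSeries_eq_constantCoeff_of_hasValueAt_zero 2 hval'
    exact mul_right_cancel₀ hx0 (h1.trans h2.symm)
  have ht : t = 1 := by
    have h : (2 : ℝ) ^ (-t) = (2 : ℝ) ^ (-(1 : ℤ)) := by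
      rw [← hu, huu, hu']; norm_num
    have hinj := zpow_right_injective₀ (by norm_num : (0 : ℝ) < 2) (by norm_num : (2 : ℝ) ≠ 1) h
    omega
  refine ⟨n, hn, ?_⟩
  rw [hnf, ht, X11b.padicValNat_tamagawaProductSplit_eq_of_heegner_prime W K 2 hN hHN]

/-- **`stub_descent_two` FROM THE PEN's TIED CUT (+ Milne 1972): the registered stub's statement VERBATIM** under `hMilne` (Milne 1972 §1 Thm 1,
tree named fact) and `hCV` = the statement of v4's `stub_controlValue_two` VERBATIM (research). Route: `controlTwo_of_controlValueTied` (the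
tie is pinned at `t = 1` by D2b) then `descent_two_of_controlTwo`'s kernel `bsdp_two_of_flatIMCEq_of_controlTwo_of_twist`. So v4's
`stub_grossLink_two` is not needed for the composition. CONDITIONAL; closes nothing.
[cite: Milne1972ArithmeticAV, §1 Thm. 1] [cite: JetchevSkinnerWan2017, Thm. 3.3.1 (arXiv:1512.06894 p. 11) (shape)]
[cite: LiuZhangZhang2018, Thm 1.5.1 and Thm 1.5.3 (Duke Math. J. 167 pp. 748–749)] -/
theorem descent_two_of_controlValueTied (hMilne : Milne1972.bsdQuotient_baseChange_quadratic)
    (hCV : ∀ (W : WeierstrassCurve ℚ) [W.IsElliptic] [W.IsGloballyMinimal],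
      W.HasCM → W.analyticRank = 1 → CMSplit W 2 → ¬ Good W 2 →
      ∀ (N : ℕ) [NeZero N] (K : Type) [Field K] [NumberField K] (Dt : ModularParametrizationData W N)
        (H : HeegnerDatum N (NumberField.discr K)) (ιK : K →+* ℂ) (P : (W.baseChange K).toAffine.Point),
        W.conductorNorm ℤ = N → IsImaginaryQuadratic K → SatisfiesHeegnerHypothesis N K →
        WeierstrassCurve.Affine.Point.map ιK.toRatAlgHom P = heegnerPointComplex Dt H → ¬ IsOfFinAddOrder P →
        ∀ (κ : ZpExtension K 2), κ.IsAnticyclotomic → ∀ (γ : Field.absoluteGaloisGroup K) [Fact (κ.IsTopGenerator γ)]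
          (𝔭 : HeightOneSpectrum (𝓞 K)) (h𝔭 : ((2 : ℕ) : 𝓞 K) ∈ 𝔭.asIdeal) (he : 𝔭.asIdeal.ramificationIdx (𝓞 ℚ) = 1)
          (hf : 𝔭.asIdeal.inertiaDeg (𝓞 ℚ) = 1) (𝔭' : HeightOneSpectrum (𝓞 K)) (h𝔭' : ((2 : ℕ) : 𝓞 K) ∈ 𝔭'.asIdeal),
          𝔭' ≠ 𝔭 → ∀ (he' : 𝔭'.asIdeal.ramificationIdx (𝓞 ℚ) = 1) (hf' : 𝔭'.asIdeal.inertiaDeg (𝓞 ℚ) = 1)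
          (ι' : PadicAlgCl 2 ≃+* ℂ), SchneiderFree.BranchInducesPrime 2 ι' 𝔭 →
          ∀ (ΩK : ℂ) (Ωp : ℂ_[2]) (Q : PowerSeries (PadicComplexInt 2)), ΩK ≠ 0 → Ωp ≠ 0 →
            R1.IsBDPLFunctionInt 2 ι' 𝔭 κ γ Dt.f ΩK Ωp Q →
            Module.IsTorsion (IwasawaAlgebra 2) (XAc (W.baseChange K) 2 κ 𝔭' ∅ γ) →
            ∃ t : ℤ,
              (∃ n : ℕ, XAc.HasCharValuationAt (W.baseChange K) 2 κ 𝔭' ∅ γ n ∧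
                (n : ℤ) = (padicValNat 2 (Nat.card (AddCommGroup.primaryComponent (W.baseChange K).sha 2)) : ℤ) +
                  2 * (X11b.padicLogOrd W 2 (embAt K 2 𝔭' h𝔭' he' hf') P -
                    (padicValNat 2 (AddSubgroup.zmultiples P).index : ℤ)) +
                  padicValNat 2 (X11b.tamagawaProductSplit W K) + t) ∧
              ∃ u : ℂ_[2], ‖u‖ = (2 : ℝ) ^ (-t) ∧
                IntSeries.HasValueAt Q 0
                  (u * (algebraMap ℚ_[2] ℂ_[2] (logOmega W 2 (embAt K 2 𝔭 h𝔭 he hf) P / (Dt.c : ℚ_[2]))) ^ 2)) :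
    (ToricPublishedInputs ∧
      LiuZhangZhang2018.thm151_thm153_modularCurve_heegnerVector_additive ∧
      bsdTriple_of_hasCM_of_L_one_ne_zero ∧
      (∀ (K : Type) [Field K] [NumberField K], poitouTate_selmerStructure_duality K) ∧
      (∀ (K : Type) [Field K] [NumberField K], poitouTate_sha_tateDual K) ∧
      (∀ (K : Type) [Field K] [NumberField K] (v : HeightOneSpectrum (𝓞 K)),
        localEulerPoincareCharacteristic (v.adicCompletion K)) ∧
      fieldCdLE_two_of_numberField ∧
      (∀ (K : Type) [Field K] [NumberField K] (p : ℕ) [Fact p.Prime],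
        ZpExtension.decomp_not_le_kerSubgroup_of_isAnticyclotomic K p)) →
    ∀ (W : WeierstrassCurve ℚ) [W.IsElliptic] [W.IsGloballyMinimal],
      W.HasCM → W.analyticRank = 1 → CMSplit W 2 → ¬ Good W 2 →
      (∀ (N : ℕ) [NeZero N] (K : Type) [Field K] [NumberField K] (Dt : ModularParametrizationData W N),
        W.conductorNorm ℤ = N → IsImaginaryQuadratic K → SatisfiesHeegnerHypothesis N K →
        ∀ (κ : ZpExtension K 2), κ.IsAnticyclotomic → ∀ (γ : Field.absoluteGaloisGroup K) [Fact (κ.IsTopGenerator γ)]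
          (𝔭 : HeightOneSpectrum (𝓞 K)), ((2 : ℕ) : 𝓞 K) ∈ 𝔭.asIdeal → 𝔭.asIdeal.ramificationIdx (𝓞 ℚ) = 1 →
          𝔭.asIdeal.inertiaDeg (𝓞 ℚ) = 1 → ∀ (ι' : PadicAlgCl 2 ≃+* ℂ), SchneiderFree.BranchInducesPrime 2 ι' 𝔭 →
          ∃ (ΩK : ℂ) (Ωp : ℂ_[2]) (Q : PowerSeries (PadicComplexInt 2)),
            ΩK ≠ 0 ∧ Ωp ≠ 0 ∧ R1.IsBDPLFunctionInt 2 ι' 𝔭 κ γ Dt.f ΩK Ωp Q) →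
      (∀ (N : ℕ) [NeZero N] (K : Type) [Field K] [NumberField K],
        W.conductorNorm ℤ = N → IsImaginaryQuadratic K → SatisfiesHeegnerHypothesis N K →
        ∀ (κ : ZpExtension K 2), κ.IsAnticyclotomic → ∀ (γ : Field.absoluteGaloisGroup K) [Fact (κ.IsTopGenerator γ)]
          (𝔭 : HeightOneSpectrum (𝓞 K)), ((2 : ℕ) : 𝓞 K) ∈ 𝔭.asIdeal → 𝔭.asIdeal.ramificationIdx (𝓞 ℚ) = 1 →
          𝔭.asIdeal.inertiaDeg (𝓞 ℚ) = 1 → ∀ (𝔭' : HeightOneSpectrum (𝓞 K)), ((2 : ℕ) : 𝓞 K) ∈ 𝔭'.asIdeal → 𝔭' ≠ 𝔭 →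
          Module.IsTorsion (IwasawaAlgebra 2) (XAc (W.baseChange K) 2 κ 𝔭' ∅ γ)) →
      (∀ (N : ℕ) [NeZero N] (K : Type) [Field K] [NumberField K] (Dt : ModularParametrizationData W N),
        W.conductorNorm ℤ = N → IsImaginaryQuadratic K → SatisfiesHeegnerHypothesis N K →
        ∀ (κ : ZpExtension K 2), κ.IsAnticyclotomic → ∀ (γ : Field.absoluteGaloisGroup K) [Fact (κ.IsTopGenerator γ)]
          (𝔭 : HeightOneSpectrum (𝓞 K)), ((2 : ℕ) : 𝓞 K) ∈ 𝔭.asIdeal → 𝔭.asIdeal.ramificationIdx (𝓞 ℚ) = 1 →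
          𝔭.asIdeal.inertiaDeg (𝓞 ℚ) = 1 → ∀ (𝔭' : HeightOneSpectrum (𝓞 K)), ((2 : ℕ) : 𝓞 K) ∈ 𝔭'.asIdeal → 𝔭' ≠ 𝔭 →
          ∀ (ι' : PadicAlgCl 2 ≃+* ℂ), SchneiderFree.BranchInducesPrime 2 ι' 𝔭 →
          ∀ (ΩK : ℂ) (Ωp : ℂ_[2]) (Q : PowerSeries (PadicComplexInt 2)), ΩK ≠ 0 → Ωp ≠ 0 →
            R1.IsBDPLFunctionInt 2 ι' 𝔭 κ γ Dt.f ΩK Ωp Q →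
            Module.IsTorsion (IwasawaAlgebra 2) (XAc (W.baseChange K) 2 κ 𝔭' ∅ γ) →
            (XAc.charIdeal (W.baseChange K) 2 κ 𝔭' ∅ γ).map (PowerSeries.map (R1.toCpInt 2)) = Ideal.span {Q}) →
      (∀ (N : ℕ) [NeZero N] (K : Type) [Field K] [NumberField K]
        (Wd : WeierstrassCurve ℚ) [Wd.IsElliptic] [Wd.IsGloballyMinimal],
        W.conductorNorm ℤ = N → IsImaginaryQuadratic K → SatisfiesHeegnerHypothesis N K →
        (∃ C : VariableChange ℚ, C • W.quadraticTwist (NumberField.discr K : ℚ) = Wd) →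
        (W.quadraticTwist (NumberField.discr K : ℚ)).entireLFunction 1 ≠ 0 → BSDp Wd 2) →
      BSDp W 2 := by
  intro h0 W _ _ hCM hr hsplit hng hFr hTor hEq hTw
  obtain ⟨hF, hL, -, -, -, -, -, -⟩ := h0
  have h4N : 2 ^ 2 ∣ W.conductorNorm ℤ := by
    by_contra h
    rcases hasGoodReductionAtPrime_or_hasMultiplicativeReductionAtPrime_of_not_sq_dvd_conductorNorm (V := W) h with hg | hm
    · exact hng hg
    · exact Literature.NumberTheory.EllipticCurves.Rank1Residual.not_mult_of_hasCM (W := W) hCM 2 hm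
  exact bsdp_two_of_flatIMCEq_of_controlTwo_of_twist hF hL hMilne W h4N hr hFr hTor hEq hTw
    (controlTwo_of_controlValueTied hL W h4N hFr hTor (hCV W hCM hr hsplit hng))

end Summit.BirchSwinnertonDyer.BirchSwinnertonDyer.Theorems.PrintCf2.EisensteinTwo

end
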